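import Summits.QuantumFields.BalabanUV.T4Continuum.Support.NE7K1LinHomLift

/-!
# NE7K1LinHomUpper — row NE7 (node U5), candidate route HOM, path H1L, cell K1-lin(s): **THE L-UNIFORM (HOMOGENISED) UPPER TWO-RUN
# COMPARISON** `⟨V, P_B^{Schur}V⟩ ≤ 5·(5∕2)^d·⟨V, P_A V⟩` on boxes — the constant does not depend on `L`

Lineage `b2b-balaban-t4-ne7-p2` (CRUX PROVER NE7 #2), generation 66 (sixth and closing file of g65's OPEN item (4)(ii) «L-uniform upper
constant (homogenisation)»; lens 2's supplier number (K2)♯-U, t4-ne7-idea-2 g35 `HOME/t4/ideate/NE7/lens2-g35/K2-UPPER-LDEP-NOTE.md`: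
`ρ(L) = 3L²∕(L² + 2) ↑ 3` on the alternating coarse field, so `NE7K1LinTwoRunFaces.schurB_form_le_sharp`'s `L` is the Löwner
constant only for `L ≤ 2`).  With `NE7K1LinTwoRunJensen.runA_form_le_schurB_sharp` the two-run pair at `A = 0` on boxes now reads
**`P_A ⪯ P_B^{Schur} ⪯ C(d)·P_A`, `C(d) = 5·(5∕2)^d`, UNIFORMLY IN `L`** (hence uniformly along `L ↦ L^m`, any number of RG steps
between the two runs).  All [folklore]:

* §4 the Schur test: `|c_ν(x,Y)|` is a product of one-dimensional absolute values; ROW SUM `L·Σ_Y |c_ν(x,Y)| ≤ 3·(3∕2)^d`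
  (`bondK_row_le`) and COLUMN SUM `Σ_{fine bonds}|c_ν(x,Y)| ≤ (5∕3)·((5∕3)L)^d` (`bondK_col_le`) from the four one-dimensional
  constants `ρ₀ = 3∕2`, `α₀ = 3`, `ρ₁ = 5∕3`, `α₁ = 5∕3` (`Finset.prod_univ_sum` over the box = product of segments; the fine bonds
  in direction `ν` form a box, `filter_fineBox_eq`); weighted Cauchy–Schwarz; **`energy_dir_le`**:
  `L²·Σ_{fine ν-bonds}(Φ(x+e_ν) − Φ x)² ≤ 5·(5∕2)^d·L^{d+1}·Σ_{coarse ν-bonds}(V(Y) − V(Y+e_ν))²`.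
* §5 the ordered nearest-neighbour pair energy by directions on any finite `R ⊂ ℤ^{d+1}` (`nbr_sq_sum_eq`, each bond twice); the
  coarse labels of the fine box (`image_blk_fineBox`); **`schurB_form_le_hom`**: for `a > 0`, `n ≥ 1`, `L ≥ 1`, `R′ = Π_μ[0, nLM_μ)`,
  `⟨V, twoCutoffLine … 1 V⟩ ≤ 5·(5∕2)^d·⟨V, runA V⟩` for every `V`, by `NE7K1LinHomTrial.schurB_form_le_of_dirichlet` fed with the
  lift (exact block means `sum_lift_block`, Dirichlet comparison = `Σ_ν energy_dir_le`).

NUMBERS (not kernel; pure-python pre-check `work/num/homlift.py` of this lineage's g66 folder, exact rational identities + float sup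
ratios): the lift's ratio vs the true sup `C*`: `d+1 = 1`, `n = 8`: `L = 2, 3, 4, 8, 12` → `1.94∕1.93`, `2.40∕2.33`, `2.60∕2.51`,
`2.83∕2.71`, `2.88∕2.75`; `d+1 = 2`, `n = 3`: `L = 2, 3` → `1.73∕1.73`, `2.22∕2.07` — the lift is near-optimal, the KERNEL constant
`5·(5∕2)^d` (= 5, 12.5, 31.25, 78.125 for `d+1 = 1…4`) is the crude Schur-test product, not sharp.  NOT COVERED: general unions of
`nL`-blocks (at re-entrant `n`-block corners no single-formula lift is continuous across the faces; the true constant there is not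
claimed); backgrounds `A ≠ 0`; anything printed of Bałaban's.

HONEST FRAMING: Gaussian `A = 0`, finite boxes, finite real matrices, [folklore] over the tree's `B4Lower18` ∕ `NE7K1Lin*`
certificates; ONE RG step in `U = 1` gauge; a census ∕ NEEDS-CONSTANT improvement of the cell K1-lin(s) (the upper two-run constant
`L` ↦ `C(d)` independent of `L`), no letter ∕ tag ∕ size of NE7 moves; nothing printed asserted; no `sorry`.  FIXED FINITE T⁴, rung
(B)+1; NE7 NOT PRINTED ∕ NOT PROVED; spine 0∕9; NOT infinite volume, NOT mass gap, NOT Clay.  HONEST DEPENDENCY: continuum YM on T⁴ ⇐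
BetaPertH ∧ nine spine estimates (0/9 proved); BetaPertH ⇐ (D1) ∧ (D4) ∧ CAP+tail; G-an2-4 gates asym, D1 and NE2/3/4.
-/

noncomputable section

open Finset Matrix

namespace Summit.QuantumFields.BalabanUV.T4Continuum.NE7K1LinHomUpper

open Literature.MathematicalPhysics.QuantumFieldTheory.Balaban1983to89
open Literature.MathematicalPhysics.QuantumFieldTheory.Balaban1983to89.B4Reflection242
open Literature.MathematicalPhysics.QuantumFieldTheory.Balaban1983to89.B4BoxCov237
open Literature.MathematicalPhysics.QuantumFieldTheory.Balaban1983to89.B4Lower18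
open Literature.MathematicalPhysics.QuantumFieldTheory.Balaban1983to89.B4Green244 (finePt)
open NE7K1LinHomKernel NE7K1LinHomKernelSums NE7K1LinHomKernelBond
open NE7K1LinHomLift

variable {d : ℕ}

/-! ### §4 The Schur test: row and column absolute sums of the bond kernel `c_ν`, and the directional energy bound -/

section Schur

variable {N : Fin (d + 1) → ℕ} {L : ℕ}

/-- the fine box `Π_μ [0, N_μ L)`. [folklore] -/
abbrev fineBox (N : Fin (d + 1) → ℕ) (L : ℕ) : Finset (Fin (d + 1) → ℤ) := boxDom (fun μ => N μ * L)

/-- the absolute value of the bond kernel is a product of one-dimensional absolute values. [folklore] -/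
theorem abs_bondK (ν : Fin (d + 1)) (x Y : Fin (d + 1) → ℤ) :
    |bondK N L ν x Y| = ∏ μ, (if μ = ν then |bondF (N μ) L (x μ) (Y μ)| else |kerF (N μ) L (x μ) (Y μ)|) := by
  unfold bondK
  rw [Finset.abs_prod]
  exact Finset.prod_congr rfl fun μ _ => by split_ifs <;> rfl

/-- `Π_μ (if μ = ν then a else b) = a · b^d` over the `d + 1` directions. [folklore] -/
theorem prod_ite_eq_mul_pow (ν : Fin (d + 1)) (a b : ℝ) : ∏ μ : Fin (d + 1), (if μ = ν then a else b) = a * b ^ d := by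
  rw [prod_eq_mul_prod_erase ν, if_pos rfl]
  congr 1
  rw [Finset.prod_congr rfl fun μ hμ => if_neg (Finset.ne_of_mem_erase hμ), Finset.prod_const, Finset.card_erase_of_mem
    (Finset.mem_univ ν), Finset.card_univ, Fintype.card_fin, Nat.add_sub_cancel]

/-- **ROW SUM** of the bond kernel: `L·Σ_{Y ∈ box} |c_ν(x, Y)| ≤ 3·(3∕2)^d` at every fine bond `(x, x + e_ν)` of the fine box.
[folklore] -/
theorem bondK_row_le (hL : 1 ≤ L) (ν : Fin (d + 1)) {x : Fin (d + 1) → ℤ} (hx : x ∈ fineBox N L)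
    (hx1 : x ν + 1 < N ν * L) :
    (L : ℝ) * ∑ Y ∈ boxDom N, |bondK N L ν x Y| ≤ 3 * (3 / 2 : ℝ) ^ d := by
  have hLr : (0 : ℝ) < L := by exact_mod_cast hL
  have hxμ : ∀ μ, 0 ≤ x μ ∧ x μ < N μ * L := fun μ => by
    have := (mem_boxDom.1 hx) μ; push_cast at this; exact this
  simp_rw [abs_bondK]
  rw [show boxDom N = Fintype.piFinset (fun μ => Finset.Ico (0 : ℤ) (N μ)) from rfl,
    ← Finset.prod_univ_sum (fun μ => Finset.Ico (0 : ℤ) (N μ))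
      (fun μ y => if μ = ν then |bondF (N μ) L (x μ) y| else |kerF (N μ) L (x μ) y|)]
  -- each one-dimensional factor
  have hfac : ∀ μ, ∑ y ∈ Finset.Ico (0 : ℤ) (N μ), (if μ = ν then |bondF (N μ) L (x μ) y| else |kerF (N μ) L (x μ) y|) ≤
      if μ = ν then 3 / (L : ℝ) else 3 / 2 := by
    intro μ
    by_cases hμ : μ = ν
    · subst hμ
      simp only [if_true]
      rw [sum_Ico_eq_sum_range, le_div_iff₀ hLr, mul_comm]
      exact bondF_row_abs' hL (hxμ μ).1 hx1
    · simp only [hμ, if_false]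
      rw [sum_Ico_eq_sum_range]
      exact kerF_row_abs' hL (hxμ μ).1 (hxμ μ).2
  have hnn : ∀ μ, 0 ≤ ∑ y ∈ Finset.Ico (0 : ℤ) (N μ), (if μ = ν then |bondF (N μ) L (x μ) y| else |kerF (N μ) L (x μ) y|) :=
    fun μ => Finset.sum_nonneg fun _ _ => by split_ifs <;> exact abs_nonneg _
  have hprod := Finset.prod_le_prod (s := Finset.univ) (fun μ _ => hnn μ) (fun μ _ => hfac μ)
  rw [prod_ite_eq_mul_pow] at hprod
  calc (L : ℝ) * ∏ μ, ∑ y ∈ Finset.Ico (0 : ℤ) (N μ), (if μ = ν then |bondF (N μ) L (x μ) y| else |kerF (N μ) L (x μ) y|)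
      ≤ (L : ℝ) * (3 / L * (3 / 2 : ℝ) ^ d) := mul_le_mul_of_nonneg_left hprod hLr.le
    _ = 3 * (3 / 2 : ℝ) ^ d := by field_simp

/-- the fine bonds in direction `ν` form a box: `{x ∈ fine box : x + e_ν ∈ fine box} = Π_μ [0, N_μ L − [μ = ν])`. [folklore] -/
theorem filter_fineBox_eq (ν : Fin (d + 1)) :
    (fineBox N L).filter (fun x => x + uvec ν ∈ fineBox N L) =
      Fintype.piFinset (fun μ => if μ = ν then Finset.Ico (0 : ℤ) ((N μ * L : ℕ) - 1) else Finset.Ico (0 : ℤ) (N μ * L : ℕ)) := by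
  ext x
  rw [Finset.mem_filter, Fintype.mem_piFinset]
  constructor
  · rintro ⟨hx, hxe⟩ μ
    have h1 := (mem_boxDom.1 hx) μ
    have h2 := (mem_boxDom.1 hxe) μ
    by_cases hμ : μ = ν
    · subst hμ
      rw [Pi.add_apply, uvec_apply_same] at h2
      rw [if_pos rfl, Finset.mem_Ico]
      exact ⟨h1.1, by push_cast at h2 ⊢; omega⟩
    · rw [if_neg hμ, Finset.mem_Ico]
      exact_mod_cast h1
  · intro h
    have hx : x ∈ fineBox N L := by
      rw [fineBox, mem_boxDom]
      intro μ
      have := h μ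
      by_cases hμ : μ = ν
      · subst hμ; rw [if_pos rfl, Finset.mem_Ico] at this; push_cast at this ⊢; omega
      · rw [if_neg hμ, Finset.mem_Ico] at this; exact_mod_cast this
    refine ⟨hx, (add_uvec_mem_boxDom ν hx).2 ?_⟩
    have := h ν
    rw [if_pos rfl, Finset.mem_Ico] at this
    push_cast at this ⊢
    omega

/-- **COLUMN SUM** of the bond kernel: `Σ_{fine bonds (x, x+e_ν)} |c_ν(x, Y)| ≤ (5∕3)·((5∕3)L)^d` at every coarse site `Y` of the
box. [folklore] -/
theorem bondK_col_le (hL : 1 ≤ L) (ν : Fin (d + 1)) {Y : Fin (d + 1) → ℤ} (hY : Y ∈ boxDom N) :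
    ∑ x ∈ (fineBox N L).filter (fun x => x + uvec ν ∈ fineBox N L), |bondK N L ν x Y| ≤
      5 / 3 * (5 / 3 * (L : ℝ)) ^ d := by
  have hYμ : ∀ μ, 0 ≤ Y μ ∧ Y μ < N μ := fun μ => (mem_boxDom.1 hY) μ
  simp_rw [abs_bondK]
  rw [filter_fineBox_eq, ← Finset.prod_univ_sum
    (fun μ => if μ = ν then Finset.Ico (0 : ℤ) ((N μ * L : ℕ) - 1) else Finset.Ico (0 : ℤ) (N μ * L : ℕ))
    (fun μ s => if μ = ν then |bondF (N μ) L s (Y μ)| else |kerF (N μ) L s (Y μ)|)]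
  have hfac : ∀ μ, ∑ s ∈ (if μ = ν then Finset.Ico (0 : ℤ) ((N μ * L : ℕ) - 1) else Finset.Ico (0 : ℤ) (N μ * L : ℕ)),
      (if μ = ν then |bondF (N μ) L s (Y μ)| else |kerF (N μ) L s (Y μ)|) ≤ if μ = ν then 5 / 3 else 5 / 3 * (L : ℝ) := by
    intro μ
    by_cases hμ : μ = ν
    · subst hμ
      simp only [if_true]
      calc ∑ s ∈ Finset.Ico (0 : ℤ) ((N μ * L : ℕ) - 1), |bondF (N μ) L s (Y μ)|
          ≤ ∑ s ∈ Finset.Ico (0 : ℤ) (N μ * L : ℕ), |bondF (N μ) L s (Y μ)| :=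
            Finset.sum_le_sum_of_subset_of_nonneg (Finset.Ico_subset_Ico_right (by omega)) fun _ _ _ => abs_nonneg _
        _ ≤ 5 / 3 := by rw [sum_Ico_eq_sum_range]; exact bondF_col_abs hL (hYμ μ).1 (hYμ μ).2
    · simp only [hμ, if_false]
      rw [sum_Ico_eq_sum_range]
      exact kerF_col_abs hL (hYμ μ).1 (hYμ μ).2
  have hnn : ∀ μ, 0 ≤ ∑ s ∈ (if μ = ν then Finset.Ico (0 : ℤ) ((N μ * L : ℕ) - 1) else Finset.Ico (0 : ℤ) (N μ * L : ℕ)),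
      (if μ = ν then |bondF (N μ) L s (Y μ)| else |kerF (N μ) L s (Y μ)|) :=
    fun μ => Finset.sum_nonneg fun _ _ => by split_ifs <;> exact abs_nonneg _
  have hprod := Finset.prod_le_prod (s := Finset.univ) (fun μ _ => hnn μ) (fun μ _ => hfac μ)
  rwa [prod_ite_eq_mul_pow] at hprod

/-- the weighted Cauchy–Schwarz step: `(Σ g·c)² ≤ (Σ|c|)·(Σ |c|·g²)`. [folklore] -/
theorem sq_sum_mul_le {ι : Type*} (s : Finset ι) (g c : ι → ℝ) :
    (∑ i ∈ s, g i * c i) ^ 2 ≤ (∑ i ∈ s, |c i|) * ∑ i ∈ s, |c i| * g i ^ 2 :=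
  Finset.sum_sq_le_sum_mul_sum_of_sq_le_mul s (fun _ _ => abs_nonneg _) (fun _ _ => by positivity)
    fun i _ => by rw [mul_pow, ← sq_abs (c i)]; exact le_of_eq (by ring)

/-- **THE DIRECTIONAL ENERGY BOUND**: for every direction `ν` and every coarse `V`,
`L²·Σ_{fine bonds (x,x+e_ν)} (Φ(x+e_ν) − Φ(x))² ≤ 5·(5∕2)^d·L^{d+1}·Σ_{coarse bonds (Y,Y+e_ν)} (V(Y) − V(Y+e_ν))²` — the
Schur test with the row and column sums above; the constant `5·(5∕2)^d` does not depend on `L`. [folklore] -/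
theorem energy_dir_le (hL : 1 ≤ L) (ν : Fin (d + 1)) (V : (Fin (d + 1) → ℤ) → ℝ) :
    (L : ℝ) ^ 2 * ∑ x ∈ (fineBox N L).filter (fun x => x + uvec ν ∈ fineBox N L),
        (lift N L V (x + uvec ν) - lift N L V x) ^ 2 ≤
      5 * (5 / 2 : ℝ) ^ d * (L : ℝ) ^ (d + 1) *
        ∑ Y ∈ (boxDom N).filter (fun Y => Y + uvec ν ∈ boxDom N), (V Y - V (Y + uvec ν)) ^ 2 := by
  have hLr : (0 : ℝ) < L := by exact_mod_cast hL
  set F := (fineBox N L).filter (fun x => x + uvec ν ∈ fineBox N L) with hF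
  set S := (boxDom N).filter (fun Y => Y + uvec ν ∈ boxDom N) with hS
  -- pointwise: Abel form + weighted Cauchy–Schwarz + row bound
  have hpt : ∀ x ∈ F, (L : ℝ) * (lift N L V (x + uvec ν) - lift N L V x) ^ 2 ≤
      3 * (3 / 2 : ℝ) ^ d * ∑ Y ∈ S, |bondK N L ν x Y| * (V Y - V (Y + uvec ν)) ^ 2 := by
    intro x hx
    rw [hF, Finset.mem_filter] at hx
    have hx0 : 0 ≤ x ν := ((mem_boxDom.1 hx.1) ν).1
    have hx1 : x ν + 1 < N ν * L := by
      have := (add_uvec_mem_boxDom ν hx.1).1 hx.2; push_cast at this; exact this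
    rw [lift_succ_sub ν V hx0 hx1]
    have hcs := sq_sum_mul_le S (fun Y => V Y - V (Y + uvec ν)) (fun Y => bondK N L ν x Y)
    have hrow : (L : ℝ) * ∑ Y ∈ S, |bondK N L ν x Y| ≤ 3 * (3 / 2 : ℝ) ^ d :=
      le_trans (mul_le_mul_of_nonneg_left (Finset.sum_le_sum_of_subset_of_nonneg (Finset.filter_subset _ _)
        fun _ _ _ => abs_nonneg _) hLr.le) (bondK_row_le hL ν hx.1 hx1)
    have hnn : 0 ≤ ∑ Y ∈ S, |bondK N L ν x Y| * (V Y - V (Y + uvec ν)) ^ 2 :=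
      Finset.sum_nonneg fun _ _ => by positivity
    calc (L : ℝ) * (∑ Y ∈ S, (V Y - V (Y + uvec ν)) * bondK N L ν x Y) ^ 2
        ≤ (L : ℝ) * ((∑ Y ∈ S, |bondK N L ν x Y|) * ∑ Y ∈ S, |bondK N L ν x Y| * (V Y - V (Y + uvec ν)) ^ 2) :=
          mul_le_mul_of_nonneg_left hcs hLr.le
      _ = ((L : ℝ) * ∑ Y ∈ S, |bondK N L ν x Y|) * ∑ Y ∈ S, |bondK N L ν x Y| * (V Y - V (Y + uvec ν)) ^ 2 := by ring
      _ ≤ 3 * (3 / 2 : ℝ) ^ d * ∑ Y ∈ S, |bondK N L ν x Y| * (V Y - V (Y + uvec ν)) ^ 2 :=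
          mul_le_mul_of_nonneg_right hrow hnn
  -- sum over the fine bonds, exchange, column bound
  have hcol : ∀ Y ∈ S, ∑ x ∈ F, |bondK N L ν x Y| ≤ 5 / 3 * (5 / 3 * (L : ℝ)) ^ d := fun Y hY =>
    bondK_col_le hL ν (Finset.mem_filter.1 hY).1
  calc (L : ℝ) ^ 2 * ∑ x ∈ F, (lift N L V (x + uvec ν) - lift N L V x) ^ 2
      = (L : ℝ) * ∑ x ∈ F, (L : ℝ) * (lift N L V (x + uvec ν) - lift N L V x) ^ 2 := by
        rw [Finset.mul_sum, Finset.mul_sum]; exact Finset.sum_congr rfl fun x _ => by ring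
    _ ≤ (L : ℝ) * ∑ x ∈ F, 3 * (3 / 2 : ℝ) ^ d * ∑ Y ∈ S, |bondK N L ν x Y| * (V Y - V (Y + uvec ν)) ^ 2 :=
        mul_le_mul_of_nonneg_left (Finset.sum_le_sum hpt) hLr.le
    _ = (L : ℝ) * (3 * (3 / 2 : ℝ) ^ d) * ∑ Y ∈ S, (V Y - V (Y + uvec ν)) ^ 2 * ∑ x ∈ F, |bondK N L ν x Y| := by
        have hx : ∑ x ∈ F, 3 * (3 / 2 : ℝ) ^ d * ∑ Y ∈ S, |bondK N L ν x Y| * (V Y - V (Y + uvec ν)) ^ 2 =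
            3 * (3 / 2 : ℝ) ^ d * ∑ Y ∈ S, (V Y - V (Y + uvec ν)) ^ 2 * ∑ x ∈ F, |bondK N L ν x Y| := by
          rw [← Finset.mul_sum, Finset.sum_comm]
          congr 1
          refine Finset.sum_congr rfl fun Y _ => ?_
          rw [Finset.mul_sum]
          exact Finset.sum_congr rfl fun x _ => by ring
        rw [hx]
        ring
    _ ≤ (L : ℝ) * (3 * (3 / 2 : ℝ) ^ d) * ∑ Y ∈ S, (V Y - V (Y + uvec ν)) ^ 2 * (5 / 3 * (5 / 3 * (L : ℝ)) ^ d) := by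
        refine mul_le_mul_of_nonneg_left (Finset.sum_le_sum fun Y hY => ?_) (by positivity)
        exact mul_le_mul_of_nonneg_left (hcol Y hY) (sq_nonneg _)
    _ = 5 * (5 / 2 : ℝ) ^ d * (L : ℝ) ^ (d + 1) * ∑ Y ∈ S, (V Y - V (Y + uvec ν)) ^ 2 := by
        rw [← Finset.sum_mul]
        have e : (L : ℝ) * (3 * (3 / 2 : ℝ) ^ d) * (5 / 3 * (5 / 3 * (L : ℝ)) ^ d) = 5 * (5 / 2 : ℝ) ^ d * (L : ℝ) ^ (d + 1) := by
          rw [mul_pow, pow_succ, show (5 / 2 : ℝ) ^ d = (3 / 2 : ℝ) ^ d * (5 / 3 : ℝ) ^ d by rw [← mul_pow]; norm_num]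
          ring
        rw [mul_comm (∑ Y ∈ S, (V Y - V (Y + uvec ν)) ^ 2), ← mul_assoc, e]

end Schur


/-! ### §5 Assembly: nearest-neighbour energies by directions; the L-UNIFORM upper two-run comparison on boxes -/

section Assembly

open NE7K1LinTwoRunFaces NE7K1LinSchurLineU1 NE7K1LinHomTrial

/-- re-indexing the backward bonds: `Σ_{x, x−e ∈ R} G(x−e, x) = Σ_{x, x+e ∈ R} G(x, x+e)`. [folklore] -/
theorem sum_filter_sub_eq (R : Finset (Fin (d + 1) → ℤ)) (e : Fin (d + 1) → ℤ)
    (G : (Fin (d + 1) → ℤ) → (Fin (d + 1) → ℤ) → ℝ) :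
    ∑ x ∈ R.filter (fun x => x - e ∈ R), G (x - e) x = ∑ x ∈ R.filter (fun x => x + e ∈ R), G x (x + e) := by
  refine Finset.sum_nbij' (fun x => x - e) (fun x => x + e) ?_ ?_ ?_ ?_ ?_
  · intro x hx
    rw [Finset.mem_filter] at hx ⊢
    exact ⟨hx.2, by rw [sub_add_cancel]; exact hx.1⟩
  · intro x hx
    rw [Finset.mem_filter] at hx ⊢
    exact ⟨hx.2, by rw [add_sub_cancel_right]; exact hx.1⟩
  · intro x _; simp
  · intro x _; simp
  · intro x _; rw [sub_add_cancel]

/-- **THE NEAREST-NEIGHBOUR ENERGY BY DIRECTIONS**: on any finite `R ⊂ ℤ^{d+1}`,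
`Σ_{x∈R}Σ_{y∈R}[y ~ x](Φ x − Φ y)² = 2·Σ_ν Σ_{x, x+e_ν ∈ R}(Φ(x+e_ν) − Φ x)²` (each bond twice in the ordered pair sum).
[folklore] -/
theorem nbr_sq_sum_eq (R : Finset (Fin (d + 1) → ℤ)) (Φ : (Fin (d + 1) → ℤ) → ℝ) :
    ∑ x ∈ R, ∑ y ∈ R, (if y ∈ nbrs x then (Φ x - Φ y) ^ 2 else (0 : ℝ)) =
      2 * ∑ ν : Fin (d + 1), ∑ x ∈ R.filter (fun x => x + uvec ν ∈ R), (Φ (x + uvec ν) - Φ x) ^ 2 := by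
  classical
  have hin : ∀ x ∈ R, ∑ y ∈ R, (if y ∈ nbrs x then (Φ x - Φ y) ^ 2 else (0 : ℝ)) =
      ∑ ν : Fin (d + 1), ((if x + uvec ν ∈ R then (Φ x - Φ (x + uvec ν)) ^ 2 else 0) +
        (if x - uvec ν ∈ R then (Φ x - Φ (x - uvec ν)) ^ 2 else 0)) := by
    intro x _
    rw [← Finset.sum_congr rfl fun y _ => sum_dir_ite_eq x y ((Φ x - Φ y) ^ 2), Finset.sum_comm]
    refine Finset.sum_congr rfl fun ν _ => ?_
    rw [Finset.sum_add_distrib, Finset.sum_ite_eq' R (x + uvec ν) (fun y => (Φ x - Φ y) ^ 2),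
      Finset.sum_ite_eq' R (x - uvec ν) (fun y => (Φ x - Φ y) ^ 2)]
  rw [Finset.sum_congr rfl hin, Finset.sum_comm, Finset.mul_sum]
  refine Finset.sum_congr rfl fun ν _ => ?_
  rw [Finset.sum_add_distrib, ← Finset.sum_filter, ← Finset.sum_filter,
    sum_filter_sub_eq R (uvec ν) (fun a b => (Φ b - Φ a) ^ 2)]
  have e : ∀ x, (Φ x - Φ (x + uvec ν)) ^ 2 = (Φ (x + uvec ν) - Φ x) ^ 2 := fun x => by ring
  simp only [e]
  ring

variable {n L : ℕ} [NeZero L]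

/-- the coarse labels of the fine box `Π[0, nLM_μ)` are the coarse box `Π[0, nM_μ)`. [folklore] -/
theorem image_blk_fineBox (M : Fin (d + 1) → ℕ) :
    (boxDom fun μ => n * L * M μ).image (blk L) = boxDom fun μ => n * M μ := by
  have hL : 1 ≤ L := NeZero.one_le
  have e : (fun μ => n * L * M μ) = fun μ => L * (n * M μ) := funext fun μ => by ring
  ext Y
  rw [Finset.mem_image]
  constructor
  · rintro ⟨x, hx, rfl⟩
    rw [e] at hx
    exact blk_mem_boxDom hL hx
  · intro hY
    refine ⟨finePt L Y 0, ?_, blk_finePt hL Y 0⟩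
    rw [e]
    exact finePt_mem_boxDom L hY 0

omit [NeZero L] in
/-- the fine box as `fineBox`. [folklore] -/
theorem boxDom_eq_fineBox (M : Fin (d + 1) → ℕ) : (boxDom fun μ => n * L * M μ) = fineBox (fun μ => n * M μ) L :=
  congrArg boxDom (funext fun μ => by ring)

/-- **THE L-UNIFORM (HOMOGENISED) UPPER TWO-RUN COMPARISON ON BOXES**: for `a > 0`, `n ≥ 1`, `L ≥ 1` and a fine box
`R′ = Π_μ [0, nLM_μ)` (`hbox`; a union of `nL`-blocks, `boxDom_isBlockUnion_nL`), run B's Schur-complemented step operator at `A = 0` is below run A's step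
operator up to the constant `C(d) = 5·(5∕2)^d`, INDEPENDENT OF `L`:  `⟨V, P_B^{Schur}V⟩ ≤ 5·(5∕2)^d·⟨V, P_A V⟩` for every `V` on
run A's lattice — against `NE7K1LinTwoRunFaces.schurB_form_le_sharp`'s constant `L` (sharp at `L = 2`; for `L ≥ 3` the block-
constant trial's constant, not the Löwner one: lens 2's (K2)♯-U number `ρ(L) = 3L²∕(L²+2) ↑ 3` on the alternating field).  The
trial is the homogenised lift `Φ = Σ_Y V(Y)·Π_μ k̃_μ` (exact block means, gradients spread over the blocks), the constant the
Schur-test product `α₀α₁(ρ₀ρ₁)^d` with `ρ₀ = 3∕2`, `ρ₁ = 5∕3`, `α₀ = 3`, `α₁ = 5∕3` — not sharp (numerically the sup ratio is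
`≈ 2.75` at `d + 1 = 1`, `L = 12`, `n = 8` and `≈ 2.07` at `d + 1 = 2`, `L = 3`, `n = 3`; lift ≈ sup).  General block unions are NOT covered (corner
configurations at `n`-block faces defeat a single-formula lift). [folklore] -/
theorem schurB_form_le_hom (hn : 1 ≤ n) (M : Fin (d + 1) → ℕ) {R' : Finset (Fin (d + 1) → ℤ)}
    (hbox : R' = boxDom fun μ => n * L * M μ) (hR' : IsBlockUnion (n * L) R') {a : ℝ} (ha : 0 < a)
    (V : ↥(R'.image (blk L)) → ℝ) :
    V ⬝ᵥ (twoCutoffLine (isBlockUnion_fine hR') n a 1).mulVec V ≤ 5 * (5 / 2 : ℝ) ^ d * (V ⬝ᵥ (runA n L a R').mulVec V) := by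
  classical
  have hL : 1 ≤ L := NeZero.one_le
  set N : Fin (d + 1) → ℕ := fun μ => n * M μ with hNdef
  have hR'L : IsBlockUnion L R' := isBlockUnion_fine hR'
  have himg : R'.image (blk L) = boxDom N := by rw [hbox]; exact image_blk_fineBox M
  have hRF : R' = fineBox N L := by rw [hbox]; exact boxDom_eq_fineBox M
  -- the coarse function on all of `ℤ^{d+1}` and the lift
  set V' : (Fin (d + 1) → ℤ) → ℝ := fun Y => if h : Y ∈ R'.image (blk L) then V ⟨Y, h⟩ else 0 with hV'def
  have hV' : ∀ b : ↥(R'.image (blk L)), V' b.1 = V b := fun b => by rw [hV'def]; simp only [b.2, dite_true]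
  set φ : ↥R' → ℝ := fun x' => lift N L V' x'.1 with hφdef
  -- exact block sums
  have hφ : ∀ b, ∑ x' ∈ Finset.univ.filter (fun x' => rblk L R' x' = b), φ x' = (L : ℝ) ^ (d + 1) * V b := by
    intro b
    rw [filter_rblk_eq_image hL hR'L b, Finset.sum_image fun j _ j' _ h => rchart_injective hL hR'L b h]
    have hb : b.1 ∈ boxDom N := by rw [← himg]; exact b.2
    rw [← hV' b, ← sum_lift_block hL V' hb]
    rfl
  have hC : (1 : ℝ) ≤ 5 * (5 / 2 : ℝ) ^ d := by
    have : (1 : ℝ) ≤ (5 / 2 : ℝ) ^ d := one_le_pow₀ (by norm_num)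
    linarith
  -- the Dirichlet comparison, direction by direction
  have hfine : ∑ x' : ↥R', ∑ y' : ↥R', (if y'.1 ∈ nbrs x'.1 then (φ x' - φ y') ^ 2 else (0 : ℝ)) =
      2 * ∑ ν : Fin (d + 1), ∑ x ∈ (fineBox N L).filter (fun x => x + uvec ν ∈ fineBox N L),
        (lift N L V' (x + uvec ν) - lift N L V' x) ^ 2 := by
    rw [← nbr_sq_sum_eq, ← hRF]
    rw [Finset.sum_coe_sort R' (fun x => ∑ y' : ↥R', (if y'.1 ∈ nbrs x then (lift N L V' x - φ y') ^ 2 else (0 : ℝ)))]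
    exact Finset.sum_congr rfl fun x _ => Finset.sum_coe_sort R' (fun y => if y ∈ nbrs x then (lift N L V' x - lift N L V' y) ^ 2 else 0)
  have hcoarse : ∑ x : ↥(R'.image (blk L)), ∑ y : ↥(R'.image (blk L)), (if y.1 ∈ nbrs x.1 then (V x - V y) ^ 2 else (0 : ℝ)) =
      2 * ∑ ν : Fin (d + 1), ∑ Y ∈ (boxDom N).filter (fun Y => Y + uvec ν ∈ boxDom N), (V' Y - V' (Y + uvec ν)) ^ 2 := by
    have h1 : ∑ x : ↥(R'.image (blk L)), ∑ y : ↥(R'.image (blk L)), (if y.1 ∈ nbrs x.1 then (V x - V y) ^ 2 else (0 : ℝ)) =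
        ∑ x ∈ R'.image (blk L), ∑ y ∈ R'.image (blk L), (if y ∈ nbrs x then (V' x - V' y) ^ 2 else (0 : ℝ)) := by
      simp_rw [← hV']
      rw [Finset.sum_coe_sort (R'.image (blk L))
        (fun x => ∑ y : ↥(R'.image (blk L)), (if y.1 ∈ nbrs x then (V' x - V' y.1) ^ 2 else (0 : ℝ)))]
      exact Finset.sum_congr rfl fun x _ =>
        Finset.sum_coe_sort (R'.image (blk L)) (fun y => if y ∈ nbrs x then (V' x - V' y) ^ 2 else 0)
    rw [h1, himg, nbr_sq_sum_eq]
    congr 1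
    exact Finset.sum_congr rfl fun ν _ => Finset.sum_congr rfl fun Y _ => by ring
  have hdir : (L : ℝ) ^ 2 * ∑ x' : ↥R', ∑ y' : ↥R', (if y'.1 ∈ nbrs x'.1 then (φ x' - φ y') ^ 2 else (0 : ℝ)) ≤
      5 * (5 / 2 : ℝ) ^ d * (L : ℝ) ^ (d + 1) * ∑ x : ↥(R'.image (blk L)), ∑ y : ↥(R'.image (blk L)),
        (if y.1 ∈ nbrs x.1 then (V x - V y) ^ 2 else (0 : ℝ)) := by
    rw [hfine, hcoarse]
    calc (L : ℝ) ^ 2 * (2 * ∑ ν : Fin (d + 1), ∑ x ∈ (fineBox N L).filter (fun x => x + uvec ν ∈ fineBox N L),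
          (lift N L V' (x + uvec ν) - lift N L V' x) ^ 2)
        = ∑ ν : Fin (d + 1), 2 * ((L : ℝ) ^ 2 * ∑ x ∈ (fineBox N L).filter (fun x => x + uvec ν ∈ fineBox N L),
          (lift N L V' (x + uvec ν) - lift N L V' x) ^ 2) := by
          rw [Finset.mul_sum, Finset.mul_sum]; exact Finset.sum_congr rfl fun ν _ => by ring
      _ ≤ ∑ ν : Fin (d + 1), 2 * (5 * (5 / 2 : ℝ) ^ d * (L : ℝ) ^ (d + 1) *
          ∑ Y ∈ (boxDom N).filter (fun Y => Y + uvec ν ∈ boxDom N), (V' Y - V' (Y + uvec ν)) ^ 2) :=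
          Finset.sum_le_sum fun ν _ => mul_le_mul_of_nonneg_left (energy_dir_le hL ν V') (by norm_num)
      _ = 5 * (5 / 2 : ℝ) ^ d * (L : ℝ) ^ (d + 1) * (2 * ∑ ν : Fin (d + 1),
          ∑ Y ∈ (boxDom N).filter (fun Y => Y + uvec ν ∈ boxDom N), (V' Y - V' (Y + uvec ν)) ^ 2) := by
          rw [Finset.mul_sum, Finset.mul_sum]; exact Finset.sum_congr rfl fun ν _ => by ring
  exact schurB_form_le_of_dirichlet hn hR' ha V φ hφ hC hdir

/-- the box hypothesis of `schurB_form_le_hom` is always available. [folklore] -/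
theorem boxDom_isBlockUnion_nL (hn : 1 ≤ n) (M : Fin (d + 1) → ℕ) :
    IsBlockUnion (n * L) (boxDom fun μ : Fin (d + 1) => n * L * M μ) :=
  boxDom_isBlockUnion (Nat.one_le_iff_ne_zero.2 (Nat.mul_ne_zero (Nat.one_le_iff_ne_zero.1 hn) (NeZero.ne L))) M

end Assembly

end Summit.QuantumFields.BalabanUV.T4Continuum.NE7K1LinHomUpper
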